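import Summits.ResolutionOfSingularities.ResolutionOfSingularities.Theorems.FrobeniusClosingSteerTwoBasisDecompositionA
import HarnessLib

/-!
# [OURS · L0 W4.1] K-GG1 (D3): monomial substitutions commute with the λ-decomposition (chain W4.1 `FrobeniusClosingSteer`,
# crux stmt-ResolutionOfSingularities-16345; res-L0-w41-plan-1 RULING 192b «(D3) … typed later as `KGG1D3_signature.lean`»; `--supports … --as helper`)

HONEST FRAMING. OURS kernel file (HIRONAKA-L librarian res-D-lib-1 gen 7), proving EXACTLY AS TYPED the signature of record
`L/res-L0-w41-tri-3/kgg/KGG1D3_signature.lean` 8d90808b0531dfd0 (drafted by res-L0-w41-tri-1 `v623`, adopted by res-L0-w41-tri-3 16:50:51Z):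
`lambdaDecomp_subst_monomial` — for a monomial substitution `X i ↦ v^{m i}` (`m i ≠ 0`) sending exponents with an odd entry to exponents
with an odd entry, the λ-decomposition of FILE A (`sqPart` / `oddPart`, p549638) commutes with `MvPowerSeries.subst`. Proof (tri-1): `subst`
is a `K`-algebra map (`MvPowerSeries.substAlgHom`), so `subst F = ∑ ε, C(λ^ε)·(subst (sqPart ε))² + subst (oddPart F)`; the second summand is
again supported on odd-entry exponents (`coeff_subst_monomial_eq_zero`: `coeff e (subst G) = ∑ᶠ_d coeff d G · [e = ∑ d i • m i]`, and `hpar`);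
conclude by the uniqueness half of (D1) (`sqPart_oddPart_unique`). Instances (tri-1): the satellite chart `x ↦ x′y, z ↦ z′y`, stub-2's
`freeShift`, relabellings, multiplication by an even monomial. NOTHING here is a statement of H. Hironaka's manuscript [Hironaka2017]; OURS
chain kernel. AI-written; AI review is weaker than expert review.
-/

set_option linter.dupNamespace false

namespace Summit.ResolutionOfSingularities.ResolutionOfSingularities.Theorems.SwitchingDichotomy.TwoBasis

open scoped BigOperators

/-! ## K-GG1 (D3): monomial substitutions commute with the λ-decomposition -/

section Subst

variable {K : Type} [Field K] [CharP K 2] {c c' r : ℕ}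

omit [CharP K 2] in
/-- The substitution family `X i ↦ v^{m i}` (`m i ≠ 0`) is substitutable. [invented: ours] -/
theorem hasSubst_monomial (m : Fin c → (Fin c' →₀ ℕ)) (hm : ∀ i, m i ≠ 0) :
    MvPowerSeries.HasSubst (fun i => MvPowerSeries.monomial (m i) (1 : K)) :=
  MvPowerSeries.hasSubst_of_constantCoeff_zero fun i => by
    rw [← MvPowerSeries.coeff_zero_eq_constantCoeff_apply, MvPowerSeries.coeff_monomial, if_neg (Ne.symm (hm i))]

omit [CharP K 2] in
/-- Under `X i ↦ v^{m i}` the monomial `v^d` goes to `v^{∑ i, d i • m i}`: `d.prod (fun s n ↦ (v^{m s})^n) = v^{∑ d i • m i}`. [invented: ours] -/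
theorem prod_monomial_pow_eq (m : Fin c → (Fin c' →₀ ℕ)) (d : Fin c →₀ ℕ) :
    (d.prod fun s n => (MvPowerSeries.monomial (m s) (1 : K)) ^ n) =
      MvPowerSeries.monomial (∑ i, d i • m i) (1 : K) := by
  classical
  have hsum : ∑ i ∈ d.support, d i • m i = ∑ i, d i • m i :=
    Finset.sum_subset (Finset.subset_univ _) fun i _ hi => by
      rw [Finsupp.notMem_support_iff.mp hi, zero_smul]
  rw [Finsupp.prod, Finset.prod_congr rfl (fun s _ => MvPowerSeries.monomial_pow (m s) (1 : K) (d s)),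
    MvPowerSeries.prod_monomial, hsum]
  simp only [one_pow, Finset.prod_const_one]

omit [CharP K 2] in
/-- Coefficients of a monomial substitution: `coeff e (subst F) = ∑ᶠ d, coeff d F · [e = ∑ d i • m i]`; in particular an exponent `e` not of
the form `∑ d i • m i` with `coeff d F ≠ 0` has coefficient `0`. [invented: ours] -/
theorem coeff_subst_monomial_eq_zero (m : Fin c → (Fin c' →₀ ℕ)) (hm : ∀ i, m i ≠ 0) (F : MvPowerSeries (Fin c) K)
    {e : Fin c' →₀ ℕ} (he : ∀ d : Fin c →₀ ℕ, MvPowerSeries.coeff d F ≠ 0 → (∑ i, d i • m i) ≠ e) :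
    MvPowerSeries.coeff e (MvPowerSeries.subst (fun i => MvPowerSeries.monomial (m i) (1 : K)) F) = 0 := by
  classical
  rw [MvPowerSeries.coeff_subst (hasSubst_monomial m hm)]
  refine finsum_eq_zero_of_forall_eq_zero fun d => ?_
  rw [prod_monomial_pow_eq, MvPowerSeries.coeff_monomial]
  by_cases hd : MvPowerSeries.coeff d F = 0
  · rw [hd, zero_smul]
  · rw [if_neg (Ne.symm (he d hd)), smul_zero]

/-- **K-GG1 (D3)** SUBSTITUTION LAW: a MONOMIAL substitution `X i ↦ X^(m i)` (`m i ≠ 0`) that sends exponents with an odd entry to exponents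
with an odd entry COMMUTES with the λ-decomposition: the parts of `subst F` are the `subst` of the parts (tri-1: `subst` is a ring map, so
`subst F = ∑ ε, C(λ^ε)·(subst (sqPart ε))² + subst (oddPart)`, and `subst (oddPart F)` is again supported on odd-entry exponents by `hpar`;
conclude by the uniqueness half of (D1), `sqPart_oddPart_unique`). S (tri-1). [invented: ours] -/
theorem lambdaDecomp_subst_monomial {c' : ℕ} (lam : Fin r → K) (hB : IsTwoBasis lam) (m : Fin c → (Fin c' →₀ ℕ))
    (hm : ∀ i, m i ≠ 0) (hpar : ∀ α : Fin c →₀ ℕ, (∃ i, Odd (α i)) → ∃ j, Odd ((∑ i, α i • m i) j))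
    (F : MvPowerSeries (Fin c) K) :
    oddPart lam hB (MvPowerSeries.subst (fun i => MvPowerSeries.monomial (m i) (1 : K)) F) =
        MvPowerSeries.subst (fun i => MvPowerSeries.monomial (m i) (1 : K)) (oddPart lam hB F) ∧
      ∀ ε, sqPart lam hB (MvPowerSeries.subst (fun i => MvPowerSeries.monomial (m i) (1 : K)) F) ε =
        MvPowerSeries.subst (fun i => MvPowerSeries.monomial (m i) (1 : K)) (sqPart lam hB F ε) := by
  classical
  have ha := hasSubst_monomial (K := K) m hm
  set φ := MvPowerSeries.substAlgHom (R := K) ha with hφ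
  have hsubst : ∀ G : MvPowerSeries (Fin c) K,
      MvPowerSeries.subst (fun i => MvPowerSeries.monomial (m i) (1 : K)) G = φ G := fun G =>
    (MvPowerSeries.substAlgHom_apply ha G).symm
  -- the decomposition pushed through the algebra map `φ`
  have hF : MvPowerSeries.subst (fun i => MvPowerSeries.monomial (m i) (1 : K)) F =
      (∑ ε, MvPowerSeries.C (lamPow lam ε) *
          (MvPowerSeries.subst (fun i => MvPowerSeries.monomial (m i) (1 : K)) (sqPart lam hB F ε)) ^ 2) +
        MvPowerSeries.subst (fun i => MvPowerSeries.monomial (m i) (1 : K)) (oddPart lam hB F) := by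
    simp only [hsubst]
    conv_lhs => rw [eq_sum_sqPart_add_oddPart lam hB F]
    rw [map_add, map_sum]
    refine congrArg (· + φ (oddPart lam hB F)) (Finset.sum_congr rfl fun ε _ => ?_)
    rw [map_mul, map_pow, MvPowerSeries.c_eq_algebraMap, AlgHom.commutes, ← MvPowerSeries.c_eq_algebraMap]
  -- the odd part stays supported on exponents with an odd entry
  have hodd : ∀ α : Fin c' →₀ ℕ, (∀ i, Even (α i)) →
      MvPowerSeries.coeff α (MvPowerSeries.subst (fun i => MvPowerSeries.monomial (m i) (1 : K)) (oddPart lam hB F)) = 0 := by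
    intro α hα
    refine coeff_subst_monomial_eq_zero m hm _ fun d hd => ?_
    have hdodd : ∃ i, Odd (d i) := by
      by_contra h
      push Not at h
      exact hd (coeff_oddPart_of_even lam hB F fun i => Nat.not_odd_iff_even.mp (h i))
    obtain ⟨j, hj⟩ := hpar d hdodd
    intro heq
    rw [heq] at hj
    exact (Nat.not_even_iff_odd.mpr hj) (hα j)
  obtain ⟨hsq, ho⟩ := sqPart_oddPart_unique lam hB _ _ _ hF hodd
  exact ⟨ho, fun ε => congrFun hsq ε⟩

end Subst

end Summit.ResolutionOfSingularities.ResolutionOfSingularities.Theorems.SwitchingDichotomy.TwoBasis
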